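import Literature.NumberTheory.LFunctions.WeilTwoPrimePos59Def
import Literature.NumberTheory.LFunctions.WeilTwoPrimePos59DataPme6
import Literature.NumberTheory.LFunctions.WeilBlockRowsPZ
import HarnessLib

/-!
# Two-prime positivity certificate (a₀ = 59/100): dominance of `R = S'(κ) − UᵀU`, block 0, rows 55–59

Kernel facts by `decide +kernel`, one declaration per row. Pure proof file.
-/

noncomputable section

namespace Literature.NumberTheory.LFunctions

set_option maxHeartbeats 0 in
/-- dominance of `R = S'(κ) − UᵀU`, block 0, row 55 (positivity certificate). [folklore] -/
theorem checkDomRowPZ0_55_weilCert23P : weilCert23PBase.checkDomRowPZ weilCert23PPme weilCert23PDne weilCert23PLse weilCert23PHpe weilCert23EKappaLit 0 55 = true := by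
  decide +kernel

set_option maxHeartbeats 0 in
/-- dominance of `R = S'(κ) − UᵀU`, block 0, row 56 (positivity certificate). [folklore] -/
theorem checkDomRowPZ0_56_weilCert23P : weilCert23PBase.checkDomRowPZ weilCert23PPme weilCert23PDne weilCert23PLse weilCert23PHpe weilCert23EKappaLit 0 56 = true := by
  decide +kernel

set_option maxHeartbeats 0 in
/-- dominance of `R = S'(κ) − UᵀU`, block 0, row 57 (positivity certificate). [folklore] -/
theorem checkDomRowPZ0_57_weilCert23P : weilCert23PBase.checkDomRowPZ weilCert23PPme weilCert23PDne weilCert23PLse weilCert23PHpe weilCert23EKappaLit 0 57 = true := by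
  decide +kernel

set_option maxHeartbeats 0 in
/-- dominance of `R = S'(κ) − UᵀU`, block 0, row 58 (positivity certificate). [folklore] -/
theorem checkDomRowPZ0_58_weilCert23P : weilCert23PBase.checkDomRowPZ weilCert23PPme weilCert23PDne weilCert23PLse weilCert23PHpe weilCert23EKappaLit 0 58 = true := by
  decide +kernel

set_option maxHeartbeats 0 in
/-- dominance of `R = S'(κ) − UᵀU`, block 0, row 59 (positivity certificate). [folklore] -/
theorem checkDomRowPZ0_59_weilCert23P : weilCert23PBase.checkDomRowPZ weilCert23PPme weilCert23PDne weilCert23PLse weilCert23PHpe weilCert23EKappaLit 0 59 = true := by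
  decide +kernel


end Literature.NumberTheory.LFunctions
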